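import Literature.AlgebraicGeometry.Milne1999.LefschetzGroup
import Literature.AlgebraicGeometry.HodgeTheory.MumfordTateGroupExteriorAction
import HarnessLib

/-!
# `w(𝔾_m) ∩ Hg(X) = w(μ₂)`: the weight cocharacter meets the Hodge group (and Milne's `ker l(A)`) in `w(±1)`

Milne [Milne1999LefschetzClasses, §4 p. 659]: «the homomorphism `a ↦ (a⁻¹, a⁻²) : 𝔾_m → GL(V(A)) × 𝔾_m` takes values
in `L(A)`. Therefore `L(A)` has a canonical cocharacter `w` … `l ∘ w = -2` … the kernel of `l(A)` […] equals `S(A)`»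
— so `w(c) ∈ ker l(A)` iff `c⁻² = 1`. Deligne [Deligne1982HodgeCycles, I §3, Prop. 3.4 / 3.6]: `MT` is generated by
`Hg = G⁰` and the weight `w(𝔾_m)`; Lange [Lange2023AbelianVarietiesComplex, Rem. 7.2.2 (2)]: `MT(X) = 𝔾_m · Hg(X)`.

On the tree's Tannaka-free carriers (`HodgeTheory.hodgeGroup`, `Milne1999.specialLefschetzGroup` = the stabilisers of
the rational `(p,p)`-classes / the Lefschetz classes on all powers; `weightCocharacter X c` = `cᵏ` on `Hᵏ`), for
every smooth projective `X` of positive dimension (a non-zero divisor class of degree `2` exists,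
`Milne1999.exists_ne_zero_mem_lefschetzPowClasses_one`), all `theorem`s, no definition, no named fact:
* `w(c)` stabilises every system of even-degree classes when `c² = 1` (`weightCocharacter_mem_powClassStabilizer_of_sq_eq_one`);
* **`w(c) ∈ ker l(A)(ℂ)` iff `c² = 1`** (`weightCocharacter_mem_specialLefschetzGroup_iff`, Milne's `l ∘ w = -2`);
* **`w(c) ∈ Hg(X)(ℂ)` iff `c² = 1`** (`weightCocharacter_mem_hodgeGroup_iff`): `w(𝔾_m) ∩ Hg = w(μ₂)`, so the
  presentation `MT = w(ℂˣ) · Hg` (`mem_mumfordTateGroup_iff_exists_weightCocharacter_mul`) is unique up to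
  `(c, g) ∼ (-c, w(-1) g)` (`weightCocharacter_mul_eq_weightCocharacter_mul_iff`);
* for an abelian variety, on `H¹`: the scalar `c · 1 ∈ Hg(A)(ℂ)|_{H¹}` iff `c² = 1` (`smulOfUnit_mem_hodgeGroupOne_iff`).

## References

* [Milne1999LefschetzClasses] J. S. Milne, *Lefschetz classes on abelian varieties*, Duke Math. J. 96 (1999), §4 p. 659
  (the cocharacters `w`, `l`; `l ∘ w = -2`; `ker l = S(A)`).
* [Deligne1982HodgeCycles] P. Deligne (notes by J. S. Milne), LNM 900 (1982), I §3 (Prop. 3.4, 3.6).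
* [Lange2023AbelianVarietiesComplex] H. Lange, *Abelian Varieties over the Complex Numbers* (2023), Rem. 7.2.2 (2).
-/

open CategoryTheory
open Literature.AlgebraicTopology.SingularHomology
open Literature.AlgebraicGeometry.Motives
open Literature.AlgebraicGeometry.Milne1999

namespace Literature.AlgebraicGeometry.HodgeTheory

section Generic

variable {n : ℕ} {X : SchemeOver ℂ} {S : ∀ a p : ℕ, Set (complexBetti (cartesianPow X (a + 1)) (2 * p))}

/-- **`w(c)` with `c² = 1` stabilises every system of even-degree classes on the powers**: `w(c)` acts on `H^{2p}` by
`c^{2p} = (c²)ᵖ = 1` (the Künneth family `weightCocharacterFamily`). [cite: Milne1999LefschetzClasses, §4 p. 659 (l ∘ w = -2)] -/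
theorem weightCocharacter_mem_powClassStabilizer_of_sq_eq_one {c : ℂˣ} (hc : (c : ℂ) ^ 2 = 1) :
    weightCocharacter X c ∈ powClassStabilizer X S :=
  ⟨weightCocharacterFamily X c, isKunnethFamily_weightCocharacterFamily c, rfl, fun a p x _ ↦ by
    rw [weightCocharacterFamily_apply, pow_mul, hc, one_pow, one_smul]⟩

/-- If `w(c)` fixes a non-zero class of degree `2`, then `c² = 1`. [folklore] -/
private theorem sq_eq_one_of_weightCocharacter_apply_eq {c : ℂˣ} {x : complexBetti X (2 * 1)} (hx0 : x ≠ 0)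
    (hfix : weightCocharacter X c (2 * 1) x = x) : (c : ℂ) ^ 2 = 1 := by
  rw [weightCocharacter_apply, pow_mul, pow_one] at hfix
  have h : ((c : ℂ) ^ 2 - 1) • x = 0 := by rw [sub_smul, one_smul, hfix, sub_self]
  rcases smul_eq_zero.1 h with h | h
  · exact sub_eq_zero.1 h
  · exact absurd h hx0

/-- **`w(c) ∈ ker l(A)(ℂ)` iff `c² = 1`** (Milne p. 659: `l ∘ w = -2`, and `ker l(A) = S(A)` fixes the Lefschetz classes —
among them a non-zero divisor class of degree `2` when `dim X ≥ 1`). [cite: Milne1999LefschetzClasses, §4 p. 659 (l ∘ w = -2, ker l = S(A))] -/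
theorem weightCocharacter_mem_specialLefschetzGroup_iff (hX : IsSmoothProjective n X) (hn : 1 ≤ n) {c : ℂˣ} :
    weightCocharacter X c ∈ specialLefschetzGroup n X ↔ (c : ℂ) ^ 2 = 1 := by
  refine ⟨fun hw ↦ ?_, fun hc ↦ weightCocharacter_mem_powClassStabilizer_of_sq_eq_one hc⟩
  obtain ⟨x, hx, hx0⟩ := exists_ne_zero_mem_lefschetzPowClasses_one hX hn
  exact sq_eq_one_of_weightCocharacter_apply_eq hx0 (apply_eq_self_of_mem_powClassStabilizer hw hx)

/-- **`w(𝔾_m) ∩ Hg(X) = w(μ₂)`: `w(c) ∈ Hg(X)(ℂ)` iff `c² = 1`** for every smooth projective `X` of positive dimension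
(`Hg ≤ ker l(A)` fixes a non-zero divisor class of degree `2`; conversely `w(±1)` fixes all even-degree classes). With
`MT = w(ℂˣ) · Hg` (`mem_mumfordTateGroup_iff_exists_weightCocharacter_mul`) this is the kernel of
`𝔾_m × Hg → MT`. [cite: Milne1999LefschetzClasses, §4 pp. 659–660 (l ∘ w = -2, L(A) ⊃ Hg(A))]
[cite: Deligne1982HodgeCycles, I Prop. 3.4 and 3.6] [cite: Lange2023AbelianVarietiesComplex, Rem. 7.2.2 (2)] -/
theorem weightCocharacter_mem_hodgeGroup_iff (hX : IsSmoothProjective n X) (hn : 1 ≤ n) {c : ℂˣ} :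
    weightCocharacter X c ∈ hodgeGroup n X ↔ (c : ℂ) ^ 2 = 1 := by
  refine ⟨fun hw ↦ ?_, fun hc ↦ weightCocharacter_mem_powClassStabilizer_of_sq_eq_one hc⟩
  exact (weightCocharacter_mem_specialLefschetzGroup_iff hX hn).1 (hodgeGroup_le_specialLefschetzGroup hX hw)

/-- `w(-1) ∈ Hg(X)(ℂ)` (it acts by `(-1)ᵏ` on `Hᵏ`, trivially on every `H^{2p}`). [cite: Milne1999LefschetzClasses, §4 p. 659 (l ∘ w = -2)] -/
theorem weightCocharacter_neg_one_mem_hodgeGroup : weightCocharacter X (-1) ∈ hodgeGroup n X :=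
  weightCocharacter_mem_powClassStabilizer_of_sq_eq_one (by simp)

/-- `w(c) ∈ Hg(X)(ℂ)` iff `c = 1` or `c = -1` (`dim X ≥ 1`). [cite: Milne1999LefschetzClasses, §4 p. 659 (l ∘ w = -2)]
[cite: Lange2023AbelianVarietiesComplex, Rem. 7.2.2 (2)] -/
theorem weightCocharacter_mem_hodgeGroup_iff_eq_or (hX : IsSmoothProjective n X) (hn : 1 ≤ n) {c : ℂˣ} :
    weightCocharacter X c ∈ hodgeGroup n X ↔ c = 1 ∨ c = -1 := by
  rw [weightCocharacter_mem_hodgeGroup_iff hX hn, sq, mul_self_eq_one_iff]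
  simp only [Units.ext_iff, Units.val_one, Units.val_neg]

/-- **Uniqueness of `m = w(c) · g` up to sign**: if `w(c) · g = w(c') · g'` with `g, g' ∈ Hg(X)(ℂ)` (`dim X ≥ 1`), then
`c = c'` or `c = -c'` (`w(c'⁻¹c) = g'g⁻¹ ∈ Hg ∩ w(𝔾_m) = w(μ₂)`). [cite: Milne1999LefschetzClasses, §4 p. 659 (l ∘ w = -2)]
[cite: Lange2023AbelianVarietiesComplex, Rem. 7.2.2 (2)] -/
theorem eq_or_eq_neg_of_weightCocharacter_mul_eq (hX : IsSmoothProjective n X) (hn : 1 ≤ n) {c c' : ℂˣ}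
    {g g' : ∀ k : ℕ, complexBetti X k ≃ₗ[ℂ] complexBetti X k} (hg : g ∈ hodgeGroup n X) (hg' : g' ∈ hodgeGroup n X)
    (h : weightCocharacter X c * g = weightCocharacter X c' * g') : c = c' ∨ c = -c' := by
  have hmem : weightCocharacter X (c'⁻¹ * c) ∈ hodgeGroup n X := by
    have e : (weightCocharacter X c')⁻¹ * weightCocharacter X c = g' * g⁻¹ := by
      calc (weightCocharacter X c')⁻¹ * weightCocharacter X c
          = (weightCocharacter X c')⁻¹ * (weightCocharacter X c * g) * g⁻¹ := by group
        _ = (weightCocharacter X c')⁻¹ * (weightCocharacter X c' * g') * g⁻¹ := by rw [h]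
        _ = g' * g⁻¹ := by group
    rw [weightCocharacter_mul, weightCocharacter_inv, e]
    exact (hodgeGroup n X).mul_mem hg' ((hodgeGroup n X).inv_mem hg)
  rcases (weightCocharacter_mem_hodgeGroup_iff_eq_or hX hn).1 hmem with h1 | h1
  · left
    exact (inv_mul_eq_one.1 h1).symm
  · right
    rw [inv_mul_eq_iff_eq_mul, mul_neg_one] at h1
    exact h1

end Generic

/-! ### Abelian varieties: the scalars in `Hg(A)(ℂ)|_{H¹}` -/

section Abelian

variable {A : AbelianVariety ℂ}

/-- **The scalar `c · 1` lies in `Hg(A)(ℂ)|_{H¹}` iff `c² = 1`** (`dim A ≥ 1`): an element of the Hodge group with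
`g₁ = c · 1` acts on `H² = ⋀²H¹` by `c²` (`hodgeGroup_apply_cupPowOne`) and fixes a non-zero divisor class; conversely
`w(±1) ∈ Hg(A)(ℂ)` has `w(±1)₁ = ±1`. (van Geemen 6.4: `G ⊂ SL(V)`; `SL ∩ 𝔾_m` on `V` is finite.)
[cite: vanGeemen1994HodgeAV, 6.4–6.5] [cite: Milne1999LefschetzClasses, §4 p. 659 (l ∘ w = -2)] -/
theorem smulOfUnit_mem_hodgeGroupOne_iff (hA : 1 ≤ A.dim) {c : ℂˣ} :
    LinearEquiv.smulOfUnit c ∈ VanGeemen1994.hodgeGroupOne A.dim A.X ↔ (c : ℂ) ^ 2 = 1 := by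
  constructor
  · intro hu
    obtain ⟨g, hg, hg1⟩ := VanGeemen1994.mem_hodgeGroupOne_iff.1 hu
    -- `g` acts on `H² = ⋀²H¹` by `c²`
    have hspan := (abelianVarietyCohomologyExteriorH1_holds.hasExteriorCohomologyH1 A).span_range_cupPowOne (2 * 1)
    have key : (g (2 * 1) : complexBetti A.X (2 * 1) →ₗ[ℂ] complexBetti A.X (2 * 1)) =
        ((c : ℂ) ^ (2 * 1)) • LinearMap.id := by
      refine LinearMap.ext_on_range hspan fun v ↦ ?_
      rw [LinearEquiv.coe_coe, hodgeGroup_apply_cupPowOne hg, LinearMap.smul_apply, LinearMap.id_apply, hg1]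
      have hv : (fun j ↦ LinearEquiv.smulOfUnit c (v j)) = fun j ↦ (c : ℂ) • v j := by
        funext j
        simp [LinearEquiv.smulOfUnit, Units.smul_def]
      rw [hv, MultilinearMap.map_smul_univ, Finset.prod_const, Finset.card_univ, Fintype.card_fin]
    obtain ⟨x, hx, hx0⟩ := exists_ne_zero_mem_lefschetzPowClasses_one
      (AbelianVariety.isSmoothProjective_holds (A := A)) hA
    have hfix : g (2 * 1) x = x := apply_eq_self_of_mem_powClassStabilizer
      (hodgeGroup_le_specialLefschetzGroup AbelianVariety.isSmoothProjective_holds hg) hx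
    have h2 : g (2 * 1) x = ((c : ℂ) ^ 2) • x := by
      have := LinearMap.congr_fun key x
      rw [pow_mul, pow_one, LinearEquiv.coe_coe, LinearMap.smul_apply, LinearMap.id_apply] at this
      exact this
    have h : ((c : ℂ) ^ 2 - 1) • x = 0 := by rw [sub_smul, one_smul, ← h2, hfix, sub_self]
    rcases smul_eq_zero.1 h with h | h
    · exact sub_eq_zero.1 h
    · exact absurd h hx0
  · intro hc
    refine VanGeemen1994.mem_hodgeGroupOne_iff.2 ⟨weightCocharacter A.X c,
      (weightCocharacter_mem_hodgeGroup_iff AbelianVariety.isSmoothProjective_holds hA).2 hc, ?_⟩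
    change LinearEquiv.smulOfUnit (c ^ 1) = _
    rw [pow_one]

/-- `-1 ∈ Hg(A)(ℂ)|_{H¹}`. [cite: vanGeemen1994HodgeAV, 6.4] -/
theorem smulOfUnit_neg_one_mem_hodgeGroupOne (hA : 1 ≤ A.dim) :
    LinearEquiv.smulOfUnit (-1 : ℂˣ) ∈ VanGeemen1994.hodgeGroupOne A.dim A.X :=
  (smulOfUnit_mem_hodgeGroupOne_iff hA).2 (by simp)

end Abelian

end Literature.AlgebraicGeometry.HodgeTheory
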